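import Literature.AlgebraicGeometry.Motives.AbelianVarietyDegree
import Literature.AlgebraicGeometry.Motives.AbelianVarietyProduct
import HarnessLib

/-!
# The box product `p₁^*D + p₂^*E` of ample divisors is ample

Family `hodge` / `motives`, layer `Literature/AlgebraicGeometry/Motives`. For schemes `X`, `Y` over
an affine base `S` with fibre product `P = X ×_S Y`, projections `p₁`, `p₂`, and ample Cartier
divisors `D` on `X`, `E` on `Y` (in the tree's form of Görtz–Wedhorn I, Prop. 13.47 (iv):
`X` is covered by affine non-vanishing loci `X_s` of sections `s ∈ Γ(X, 𝒪(d • D))`), the divisor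
`p₁^*D + p₂^*E` on `P` is ample: `P_{p₁^*s^e · p₂^*t^d} = p₁⁻¹(X_s) ∩ p₂⁻¹(Y_t) = X_s ×_S Y_t` is
affine (a fibre product of affine schemes over an affine scheme, embedded in `P` by the open
immersion `pullback.map`) and these loci cover `P`. This is Görtz–Wedhorn I, Prop. 13.50 (4)
("`𝓛 ⊗ 𝓛'` is ample") combined with Prop. 13.66 (2)/(13.16.4) for the two projections — in
EGA II (4.6.13 (iv)): "si `𝓛` est ample et `𝓛'` ample, `𝓛 ⊗_S 𝓛'` est ample sur `X ×_S X'`" — and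
for abelian varieties the standard fact that `p₁^*Θ₁ ⊗ p₂^*Θ₂` polarises `A × B`
(Lange, §2.1.1 with Exercise 2.6 (3); Mumford §6).

## Results

* `isAffineOpen_pullback_fst_preimage_inf_snd_preimage` — `p₁⁻¹U ∩ p₂⁻¹V ⊆ X ×_S Y` is an affine
  open for affine opens `U ⊆ X`, `V ⊆ Y` and affine `S` (the pattern of Mathlib's
  `IsAffineOpen.isCompact_pullback_inf`).
* `CartierDivisor.IsAmple.boxProduct` — `p₁^*D + p₂^*E` is ample on `X ×_S Y` for `D`, `E` ample.
* `AbelianVariety.isAmple_boxProduct` — for abelian varieties `A`, `B` over a field and ample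
  `Θ₁`, `Θ₂`: `fst^*Θ₁ + snd^*Θ₂` is ample on `A × B`.

Everything is proved; no definition and no named fact is introduced.

## References

* [GortzWedhorn2020] U. Görtz, T. Wedhorn, *Algebraic Geometry I*, 2nd ed. (2020), Prop. 4.32 (2)
  (p. 137), Prop. 13.47 (iv) and Def. 13.44 (p. 493), Prop. 13.50 (4) (p. 496), Prop. 13.66 (2) (p. 509).
* [EGAII] A. Grothendieck, *Éléments de géométrie algébrique II*, Publ. Math. IHÉS 8 (1961),
  Prop. 4.6.13 (iv).
* [Lange2023AbelianVarietiesComplex] H. Lange, *Abelian Varieties over the Complex Numbers* (2023),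
  §2.1.1.
-/

noncomputable section

universe u

open CategoryTheory CategoryTheory.Limits AlgebraicGeometry TopologicalSpace Opposite

namespace Literature.AlgebraicGeometry.Motives

open RatFn

/-! ### `p₁⁻¹U ∩ p₂⁻¹V` is affine -/

/-- **`p₁⁻¹(U) ∩ p₂⁻¹(V) = U ×_S V` is an affine open of `X ×_S Y`** for affine opens `U ⊆ X`,
`V ⊆ Y` over an affine `S`: it is the range of the open immersion
`pullback.map : U ×_S V ⟶ X ×_S Y` (Mathlib `Scheme.Pullback.range_map`), and `U ×_S V` is affine
(Görtz–Wedhorn I, Prop. 4.20 / (4.9): fibre products of affine schemes are affine; the pattern of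
Mathlib's `IsAffineOpen.isCompact_pullback_inf`). [cite: GortzWedhorn2020, Thm. 4.18 and Prop. 4.20 (fibre products of affine schemes)] -/
theorem isAffineOpen_pullback_fst_preimage_inf_snd_preimage {X Y S : Scheme.{u}} [IsAffine S]
    (u : X ⟶ S) (v : Y ⟶ S) {U : X.Opens} (hU : IsAffineOpen U) {V : Y.Opens} (hV : IsAffineOpen V) :
    IsAffineOpen (Limits.pullback.fst u v ⁻¹ᵁ U ⊓ Limits.pullback.snd u v ⁻¹ᵁ V) := by
  haveI : IsAffine U.toScheme := hU
  haveI : IsAffine V.toScheme := hV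
  let p : Limits.pullback (U.ι ≫ u) (V.ι ≫ v) ⟶ Limits.pullback u v :=
    Limits.pullback.map _ _ _ _ U.ι V.ι (𝟙 S) (by simp) (by simp)
  have hr : (Scheme.Hom.opensRange p : (Limits.pullback u v).Opens) =
      Limits.pullback.fst u v ⁻¹ᵁ U ⊓ Limits.pullback.snd u v ⁻¹ᵁ V := by
    ext z
    change z ∈ Set.range p ↔ _
    rw [Scheme.Pullback.range_map]
    simp
  rw [← hr]
  exact isAffineOpen_opensRange p

namespace CartierDivisor

variable {X Y S : Scheme.{u}} [IsIntegral X] [IsIntegral Y] [IsAffine S] (u : X ⟶ S) (v : Y ⟶ S)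
  [IsIntegral (Limits.pullback u v)] [IsDominant (Limits.pullback.fst u v)]
  [IsDominant (Limits.pullback.snd u v)]

/-- **The box product of ample divisors is ample**: for ample `D` on `X` and `E` on `Y` (over an
affine `S`, `X ×_S Y` integral and quasi-compact quasi-separated, projections dominant),
`p₁^*D + p₂^*E` is ample on `X ×_S Y`. With `d`, `e` and sections `s ∈ Γ(X, 𝒪(dD))`,
`t ∈ Γ(Y, 𝒪(eE))` as in Görtz–Wedhorn I, Prop. 13.47 (iv), the section `p₁^*s^e · p₂^*t^d` of
`𝒪((de) • (p₁^*D + p₂^*E))` has non-vanishing locus `p₁⁻¹(X_s) ∩ p₂⁻¹(Y_t)` (Remark 13.46 (3):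
`X_f ∩ X_g = X_{f ⊗ g}`, and `p⁻¹(X_s) = P_{p^*s}`), which is affine
(`isAffineOpen_pullback_fst_preimage_inf_snd_preimage`), and these loci cover. EGA II 4.6.13 (iv);
Görtz–Wedhorn I, Prop. 13.50 (4) with Prop. 13.66 (2).
[cite: GortzWedhorn2020, Prop. 13.50 (4) (p. 496) and Prop. 13.47 (iv) (p. 493)] [cite: EGAII, Prop. 4.6.13 (iv)] -/
theorem IsAmple.boxProduct [CompactSpace ↥(Limits.pullback u v)] [QuasiSeparatedSpace ↥(Limits.pullback u v)]
    {D : CartierDivisor X} {E : CartierDivisor Y} (hD : D.IsAmple) (hE : E.IsAmple) :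
    (D.pullback (Limits.pullback.fst u v) + E.pullback (Limits.pullback.snd u v)).IsAmple := by
  obtain ⟨-, -, d, hd, HD⟩ := hD
  obtain ⟨-, -, e, he, HE⟩ := hE
  set p := Limits.pullback.fst u v with hp
  set q := Limits.pullback.snd u v with hq
  set D' := D.pullback p with hD'
  set E' := E.pullback q with hE'
  refine ⟨inferInstance, inferInstance, d * e, Nat.mul_pos hd he, fun z => ?_⟩
  obtain ⟨s₀, hs₀, hzs, hsaff⟩ := HD (p z)
  obtain ⟨t₀, ht₀, hzt, htaff⟩ := HE (q z)
  -- the pulled-back sections `s = p^*s₀ ∈ Γ(𝒪(d D'))`, `t = q^*t₀ ∈ Γ(𝒪(e E'))`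
  set s := functionFieldMap p s₀ with hs_def
  set t := functionFieldMap q t₀ with ht_def
  have hs : (d • D').IsSection s := by rw [hD', ← pullback_smul]; exact hs₀.pullback p
  have ht : (e • E').IsSection t := by rw [hE', ← pullback_smul]; exact ht₀.pullback q
  have hxs : z ∈ (d • D').nonvanishing s := by
    rw [hD', ← pullback_smul, ← preimage_nonvanishing p hs₀]; exact hzs
  have hxt : z ∈ (e • E').nonvanishing t := by
    rw [hE', ← pullback_smul, ← preimage_nonvanishing q ht₀]; exact hzt
  have hsaff' : (d • D').nonvanishingOpens s = p ⁻¹ᵁ (d • D).nonvanishingOpens s₀ := by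
    rw [preimage_nonvanishingOpens p hs₀, pullback_smul]
  have htaff' : (e • E').nonvanishingOpens t = q ⁻¹ᵁ (e • E).nonvanishingOpens t₀ := by
    rw [preimage_nonvanishingOpens q ht₀, pullback_smul]
  -- the section `s^e t^d` of `𝒪((de) • (D' + E'))` (as in `IsAmple.add`)
  refine ⟨s ^ e * t ^ d, ?_, ?_, ?_⟩
  · rintro ⟨i, j⟩ y ⟨hyi, hyj⟩
    change IsRegularAt y ((D'.f i * E'.f j) ^ (d * e) * (s ^ e * t ^ d))
    have e1 : (D'.f i * E'.f j) ^ (d * e) * (s ^ e * t ^ d) =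
        (D'.f i ^ d * s) ^ e * (E'.f j ^ e * t) ^ d := by ring
    rw [e1]
    exact ((hs i y hyi).pow e).mul ((ht j y hyj).pow d)
  · obtain ⟨i, hi, hus⟩ := hxs
    obtain ⟨j, hj, hut⟩ := hxt
    refine ⟨(i, j), ⟨hi, hj⟩, ?_⟩
    change IsUnitAt z ((D'.f i * E'.f j) ^ (d * e) * (s ^ e * t ^ d))
    have e1 : (D'.f i * E'.f j) ^ (d * e) * (s ^ e * t ^ d) =
        (D'.f i ^ d * s) ^ e * (E'.f j ^ e * t) ^ d := by ring
    rw [e1]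
    exact (hus.pow e).mul (hut.pow d)
  · have heq : ((d * e) • (D' + E')).nonvanishingOpens (s ^ e * t ^ d) =
        (d • D').nonvanishingOpens s ⊓ (e • E').nonvanishingOpens t := by
      ext y
      simp only [TopologicalSpace.Opens.coe_inf, Set.mem_inter_iff, SetLike.mem_coe,
        mem_nonvanishingOpens]
      constructor
      · rintro ⟨⟨i, j⟩, ⟨hyi, hyj⟩, hu⟩
        change IsUnitAt y ((D'.f i * E'.f j) ^ (d * e) * (s ^ e * t ^ d)) at hu
        have e1 : (D'.f i * E'.f j) ^ (d * e) * (s ^ e * t ^ d) =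
            (D'.f i ^ d * s) ^ e * (E'.f j ^ e * t) ^ d := by ring
        rw [e1] at hu
        have h1 : IsRegularAt y ((D'.f i ^ d * s) ^ e) := (hs i y hyi).pow e
        have h2 : IsRegularAt y ((E'.f j ^ e * t) ^ d) := (ht j y hyj).pow d
        refine ⟨⟨i, hyi, ?_⟩, ⟨j, hyj, ?_⟩⟩
        · exact (hs i y hyi).isUnitAt_of_pow he.ne' (h1.isUnitAt_of_mul h2 hu)
        · rw [mul_comm] at hu
          exact (ht j y hyj).isUnitAt_of_pow hd.ne' (h2.isUnitAt_of_mul h1 hu)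
      · rintro ⟨⟨i, hyi, hui⟩, ⟨j, hyj, huj⟩⟩
        refine ⟨(i, j), ⟨hyi, hyj⟩, ?_⟩
        change IsUnitAt y ((D'.f i * E'.f j) ^ (d * e) * (s ^ e * t ^ d))
        have e1 : (D'.f i * E'.f j) ^ (d * e) * (s ^ e * t ^ d) =
            (D'.f i ^ d * s) ^ e * (E'.f j ^ e * t) ^ d := by ring
        rw [e1]
        exact (hui.pow e).mul (huj.pow d)
    rw [heq, hsaff', htaff']
    exact isAffineOpen_pullback_fst_preimage_inf_snd_preimage u v hsaff htaff

end CartierDivisor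

/-! ### Abelian varieties -/

namespace AbelianVariety

variable {k : Type u} [Field k] (A B : AbelianVariety k)

/-- The structure morphism of an abelian variety is surjective (`A` is non-empty and `Spec k` is a
point). [folklore] -/
private theorem surjective_hom : Surjective A.X.hom := by
  refine ⟨fun y ↦ ?_⟩
  obtain ⟨x⟩ := (inferInstance : Nonempty A.X.left)
  haveI : Subsingleton ↥(Spec (CommRingCat.of k)) :=
    inferInstanceAs (Subsingleton (PrimeSpectrum (CommRingCat.of k)))
  exact ⟨x, Subsingleton.elim _ _⟩

/-- **The first projection `A × B → A` is dominant on schemes** — surjective, as a base change of the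
surjective `B → Spec k` (Görtz–Wedhorn I, Prop. 4.32 (2): "surjective" is stable under base change).
[cite: GortzWedhorn2020, Prop. 4.32 (2) (p. 137)] -/
theorem isDominant_fst_left : IsDominant (fst A B).hom.hom.hom.left := by
  haveI : Surjective B.X.hom := surjective_hom B
  haveI : Surjective (Limits.pullback.fst A.X.hom B.X.hom) := MorphismProperty.pullback_fst _ _ inferInstance
  change IsDominant (Limits.pullback.fst A.X.hom B.X.hom)
  infer_instance

/-- **The second projection `A × B → B` is dominant on schemes** (surjective, a base change of the
surjective `A → Spec k`; Görtz–Wedhorn I, Prop. 4.32 (2)). [cite: GortzWedhorn2020, Prop. 4.32 (2) (p. 137)] -/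
theorem isDominant_snd_left : IsDominant (snd A B).hom.hom.hom.left := by
  haveI : Surjective A.X.hom := surjective_hom A
  haveI : Surjective (Limits.pullback.snd A.X.hom B.X.hom) := MorphismProperty.pullback_snd _ _ inferInstance
  change IsDominant (Limits.pullback.snd A.X.hom B.X.hom)
  infer_instance

/-- **`p₁^*Θ₁ + p₂^*Θ₂` is ample on `A × B`** for ample `Θ₁` on `A` and `Θ₂` on `B` (abelian
varieties over a field): `CartierDivisor.IsAmple.boxProduct` — `A × B` is integral and proper, so
quasi-compact and quasi-separated; the projections are surjective. Lange §2.1.1 / Exercise 2.6 (3) (the product polarization); EGA II 4.6.13 (iv).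
[cite: GortzWedhorn2020, Prop. 13.50 (4) (p. 496)] [cite: EGAII, Prop. 4.6.13 (iv)] -/
theorem isAmple_boxProduct {Θ₁ : CartierDivisor A.X.left} {Θ₂ : CartierDivisor B.X.left}
    (h₁ : Θ₁.IsAmple) (h₂ : Θ₂.IsAmple) :
    letI := isDominant_fst_left A B
    letI := isDominant_snd_left A B
    (Θ₁.pullback (fst A B).hom.hom.hom.left + Θ₂.pullback (snd A B).hom.hom.hom.left).IsAmple := by
  haveI := (A.prod B).isProper
  haveI : CompactSpace ↥(A.prod B).X.left := QuasiCompact.compactSpace_of_compactSpace (A.prod B).X.hom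
  haveI : QuasiSeparatedSpace ↥(A.prod B).X.left := quasiSeparatedSpace_of_quasiSeparated (A.prod B).X.hom
  haveI : Surjective B.X.hom := surjective_hom B
  haveI : Surjective A.X.hom := surjective_hom A
  haveI : Surjective (Limits.pullback.fst A.X.hom B.X.hom) := MorphismProperty.pullback_fst _ _ inferInstance
  haveI : Surjective (Limits.pullback.snd A.X.hom B.X.hom) := MorphismProperty.pullback_snd _ _ inferInstance
  haveI : IsIntegral (Limits.pullback A.X.hom B.X.hom) := inferInstanceAs (IsIntegral (A.prod B).X.left)
  haveI : CompactSpace ↥(Limits.pullback A.X.hom B.X.hom) :=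
    inferInstanceAs (CompactSpace ↥(A.prod B).X.left)
  haveI : QuasiSeparatedSpace ↥(Limits.pullback A.X.hom B.X.hom) :=
    inferInstanceAs (QuasiSeparatedSpace ↥(A.prod B).X.left)
  exact CartierDivisor.IsAmple.boxProduct A.X.hom B.X.hom h₁ h₂

end AbelianVariety

end Literature.AlgebraicGeometry.Motives

end
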